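import Summits.AtomisticToContinuum.FouriersLaw.Theorems.PuiseuxTransferLedgerFiniteResponseProfile

/-!
# Limit exchange: the linear response of the kinetic temperature at every site
(stub `stub_profileLimitExchange` of line `Sketch`, crux stmt-AtomisticToContinuum-12111 `PuiseuxTransferLedger.TwoModeBulk`)

For the pinned chain `pinnedChain ω₂ lam β γ` (all `> 0`), `N + 1` sites, `T > 0`, a site `i`,
`μ₀ = gibbsMeasure (N+1) T`, `K^δ_s = transitionKernel (N+1) (T+δ/2) (T-δ/2) s`, `K_s = K^0_s`: GIVEN the finite-time
Gibbs TTCF identity for `p_i²` (the neighbouring stub `stub_profileTTCF`, taken as a hypothesis), under weak-NESS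
uniqueness and along every steady family `μ`:
`(μ_{(N+1),T+δ/2,T-δ/2}(p_i²) - T)/δ → (γ/2T²)(∫₀^∞ Y_i - ∫₀^∞ X_i)` (`δ → 0`, `δ ≠ 0`),
`Y_i(t) = Cov_{μ₀}(p_0², K_t p_i²)`, `X_i(t) = Cov_{μ₀}(p_N², K_t p_i²)`.

This is the landed `BoundaryKubo.GibbsTtcf.stub_limitExchange` (`Theorems/PhononMeanFreePathBoundaryKuboLimitExchange.lean`)
with the observable `p_N²` replaced by `p_i²`. The limit exchange proper — identification of the family member at
`0 < |δ| ≤ δ₀` with the locally uniform Harris steady state (`stub_uniformHarris_of_minorization ∘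
stub_uniformMinorization_of ∘ (stub_uniformLocalMinorization, stub_uniformBallGeHalf, stub_jointFeller)`, uniqueness),
`S → ∞` in the TTCF identity, and `δ → 0` inside the time integral by dominated convergence with kernel continuity
`stub_kernelContinuity` — is the landed `PuiseuxTransferLedgerFiniteResponseProfile.siteResponse_tendsto`, whose limit is
`(γ/2T²) Ψ_i(0)`, `Ψ_i(0) = ∫_{(0,∞)} μ₀((p_0² - p_N²) · K_s p_i²) ds`. This file supplies the value
`Ψ_i(0) = ∫ Y_i - ∫ X_i`:

* `gibbs_cov_integrableOn_site` — integrability of `t ↦ Cov_{μ₀}(p_j², K_t p_i²)` on `(0, ∞)` from a Harris bound at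
  `(a, b)` whose limit is `μ₀` (`corr_decay`);
* `integral_kubo_sub_auto_site` — `∫ Y_i - ∫ X_i = Ψ_i(0)` (the product terms cancel, `μ₀(p_0²) = μ₀(p_N²) = T`);
* `stub_profileLimitExchange` — `siteResponse_tendsto` + the Harris bound at `δ = 0` (limit `= μ₀` by uniqueness).
-/

noncomputable section

open scoped NNReal ENNReal Topology
open MeasureTheory Filter Set

namespace Summit.AtomisticToContinuum.FouriersLaw.Theorems.TwoModeBulk.Sketch

open Literature.MathematicalPhysics.KineticTheory.HeatConduction
open Literature.MathematicalPhysics.KineticTheory Literature.Probability.Process OscillatorChain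
open ProbabilityTheory
open Summit.AtomisticToContinuum.FouriersLaw.Theorems.SubdiffusiveBondHeat
open Summit.AtomisticToContinuum.FouriersLaw.Theorems.IncoherentChannel.Negative.GibbsStein (gibbs_sq_momentum)
open Summit.AtomisticToContinuum.FouriersLaw.Theorems.BoundaryKubo.Negative.LoadBearing
  (kuboIntegrand kuboValue LimitClause UniqueSteady SteadyFamily boundaryKubo_iff steadyFamily_apply_self)
open Summit.AtomisticToContinuum.FouriersLaw.Theorems.BoundaryKubo.GibbsTtcf
open Summit.AtomisticToContinuum.FouriersLaw.Theorems.PuiseuxTransferLedgerFiniteResponseProfile (siteResponse_tendsto)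

/-! ### Decay of Gibbs covariances at a general site -/

section OnePair

variable {ω₂ lam β γ : ℝ} (hω : 0 < ω₂) (hl : 0 ≤ lam) (hβ : 0 ≤ β) (hγ : 0 ≤ γ) {N : ℕ}
  {a b : ℝ} {ν : Measure (PhaseSpace (N + 1))} {θ C c : ℝ} (hθ : 0 < θ) (hc : 0 < c)
  (hH : ∀ (z : PhaseSpace (N + 1)) (t : ℝ≥0) (f : PhaseSpace (N + 1) → ℝ), Continuous f →
    (∀ y, |f y| ≤ Real.exp (θ * (pinnedChain ω₂ lam β γ).hamiltonian (N + 1) y)) →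
    |(∫ y, f y ∂((pinnedChain ω₂ lam β γ).transitionKernel (N + 1) a b t z)) - ∫ y, f y ∂ν| ≤
      C * Real.exp (θ * (pinnedChain ω₂ lam β γ).hamiltonian (N + 1) z) * Real.exp (-c * t))
  {T : ℝ} (hT : 0 < T) (hθT : θ * T < 1)
include hω hl hβ hγ hθ hc hH hT hθT

/-- **Exponential decay and integrability of a Gibbs covariance** `t ↦ μ₀(p_j² · K_t p_i²) - μ₀(p_j²) μ₀(K_t p_i²)`
when the Harris limit at `(a, b)` IS the Gibbs measure (`ν = μ₀`): integrability of `z ↦ p_j² K_t p_i²` and of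
`z ↦ K_t p_i²` under `μ₀` for every `t`, and integrability of the covariance on `(0, ∞)` (bound `M e^{-ct}` by
`corr_decay` with `g = p_j²` and `g = 1`, measurability in `t` by `measurable_corr_time`).
Adapted from `BoundaryKubo.GibbsTtcf.gibbs_cov_integrableOn` (`p_N² ↦ p_i²`). [folklore] -/
theorem gibbs_cov_integrableOn_site (hν : ν = (pinnedChain ω₂ lam β γ).gibbsMeasure (N + 1) T)
    (j i : Fin (N + 1)) :
    (∀ t : ℝ≥0, Integrable (fun z : PhaseSpace (N + 1) => z.2 j ^ 2 * ∫ y, (y.2 i) ^ 2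
        ∂((pinnedChain ω₂ lam β γ).transitionKernel (N + 1) a b t z))
        ((pinnedChain ω₂ lam β γ).gibbsMeasure (N + 1) T) ∧
      Integrable (fun z : PhaseSpace (N + 1) => ∫ y, (y.2 i) ^ 2
        ∂((pinnedChain ω₂ lam β γ).transitionKernel (N + 1) a b t z))
        ((pinnedChain ω₂ lam β γ).gibbsMeasure (N + 1) T)) ∧
    IntegrableOn (fun t : ℝ => (∫ z, (z.2 j) ^ 2 * (∫ y, (y.2 i) ^ 2
        ∂((pinnedChain ω₂ lam β γ).transitionKernel (N + 1) a b t.toNNReal z))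
        ∂((pinnedChain ω₂ lam β γ).gibbsMeasure (N + 1) T)) -
      (∫ z, (z.2 j) ^ 2 ∂((pinnedChain ω₂ lam β γ).gibbsMeasure (N + 1) T)) *
        (∫ z, (∫ y, (y.2 i) ^ 2
          ∂((pinnedChain ω₂ lam β γ).transitionKernel (N + 1) a b t.toNNReal z))
          ∂((pinnedChain ω₂ lam β γ).gibbsMeasure (N + 1) T))) (Ioi 0) := by
  set P := pinnedChain ω₂ lam β γ with hPdef
  set μ₀ := P.gibbsMeasure (N + 1) T with hμ₀
  set ϑ := (1 / T - θ) / 2 with hϑ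
  haveI : IsProbabilityMeasure μ₀ := pinnedChain_isProbabilityMeasure_gibbsMeasure hω hl hβ γ (N + 1) hT
  have hP : P.IsConfining := pinnedChain_isConfining hω hl hβ hγ
  have hθT' : θ < 1 / T := by rwa [lt_div_iff₀ hT]
  have hϑ0 : 0 < ϑ := by rw [hϑ]; linarith
  have hθϑ : θ + ϑ < 1 / T := by rw [hϑ]; linarith
  have hpT : ∀ k : Fin (N + 1), ∫ z, z.2 k ^ 2 ∂μ₀ = T := fun k => gibbs_sq_momentum hω hl hβ hT k
  have hm : ∫ y, (y.2 i) ^ 2 ∂ν = T := by rw [hν]; exact hpT _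
  have hpc : Continuous fun z : PhaseSpace (N + 1) => z.2 j ^ 2 := by fun_prop
  have hAc : Continuous fun y : PhaseSpace (N + 1) => y.2 i ^ 2 := by fun_prop
  have hpb : ∀ z : PhaseSpace (N + 1), |z.2 j ^ 2| ≤ 2 / ϑ * Real.exp (ϑ * P.hamiltonian (N + 1) z) :=
    fun z => abs_sq_momentum_le_exp hP hϑ0 (N + 1) z j
  have h1b : ∀ z : PhaseSpace (N + 1), |(1 : ℝ)| ≤ 1 * Real.exp (ϑ * P.hamiltonian (N + 1) z) := fun z => by
    rw [abs_one, one_mul]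
    exact Real.one_le_exp (mul_nonneg hϑ0.le (hP.hamiltonian_nonneg (N + 1) z))
  set I := ∫ z, Real.exp ((θ + ϑ) * P.hamiltonian (N + 1) z) ∂μ₀ with hI
  have hg := fun t : ℝ≥0 => corr_decay hω hl hβ hγ hθ hH hT hθϑ hpc hpb i t
  have h1 := fun t : ℝ≥0 => corr_decay hω hl hβ hγ hθ hH hT hθϑ continuous_const h1b i t
  simp only [one_mul, integral_const, probReal_univ, smul_eq_mul] at h1
  refine ⟨fun t => ⟨(hg t).1, (h1 t).1⟩, ?_⟩
  have h1m : Measurable fun t : ℝ => ∫ z, (∫ y, (y.2 i) ^ 2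
      ∂(P.transitionKernel (N + 1) a b t.toNNReal z)) ∂μ₀ := by
    simpa only [one_mul] using
      measurable_corr_time hω hl hβ hγ (N + 1) a b μ₀ (continuous_const (y := (1 : ℝ))) hAc
  refine integrableOn_Ioi_of_abs_le_exp hc (M := 2 / θ * C * (2 / ϑ) * I + T * (2 / θ * C * 1 * I))
    ((measurable_corr_time hω hl hβ hγ (N + 1) a b μ₀ hpc hAc).sub (h1m.const_mul _)) fun t ht => ?_
  have hgt := (hg t.toNNReal).2
  have h1t := (h1 t.toNNReal).2
  rw [Real.coe_toNNReal _ ht.le, hm] at hgt h1t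
  rw [hpT] at hgt ⊢
  set X := ∫ z, z.2 j ^ 2 * ∫ y, y.2 i ^ 2 ∂(P.transitionKernel (N + 1) a b t.toNNReal z) ∂μ₀
  set Y := ∫ z, ∫ y, y.2 i ^ 2 ∂(P.transitionKernel (N + 1) a b t.toNNReal z) ∂μ₀
  calc |X - T * Y| = |(X - T * T) - T * (Y - T)| := by ring_nf
    _ ≤ |X - T * T| + |T * (Y - T)| := abs_sub _ _
    _ ≤ 2 / θ * C * (2 / ϑ) * I * Real.exp (-c * t) + T * (2 / θ * C * 1 * I * Real.exp (-c * t)) := by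
        refine add_le_add hgt ?_
        rw [abs_mul, abs_of_pos hT]
        exact mul_le_mul_of_nonneg_left h1t hT.le
    _ = _ := by ring

end OnePair

/-! ### The value at `δ = 0`: `Ψ_i(0) = ∫ Y_i - ∫ X_i` -/

/-- **The value of the limit, at site `i`.** If the Harris limit at equal temperatures `(T, T)` is the Gibbs measure
`μ₀`, then `Y_i` and `X_i` are integrable on `(0, ∞)` and `∫ Y_i - ∫ X_i = ∫_{(0,∞)} μ₀((p_0² - p_N²) · K_s p_i²) ds`
(the product terms cancel because `μ₀(p_0²) = μ₀(p_N²) = T`).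
Adapted from `BoundaryKubo.GibbsTtcf.integral_kubo_sub_auto` (`p_N² ↦ p_i²`). [folklore] -/
theorem integral_kubo_sub_auto_site {ω₂ lam β γ : ℝ} (hω : 0 < ω₂) (hl : 0 ≤ lam) (hβ : 0 ≤ β) (hγ : 0 ≤ γ)
    {N : ℕ} {T θ C c : ℝ} (hT : 0 < T) (hθ : 0 < θ) (hθT : θ * T < 1) (hc : 0 < c)
    (hH : ∀ (z : PhaseSpace (N + 1)) (t : ℝ≥0) (f : PhaseSpace (N + 1) → ℝ), Continuous f →
      (∀ y, |f y| ≤ Real.exp (θ * (pinnedChain ω₂ lam β γ).hamiltonian (N + 1) y)) →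
      |(∫ y, f y ∂((pinnedChain ω₂ lam β γ).transitionKernel (N + 1) T T t z)) -
          ∫ y, f y ∂((pinnedChain ω₂ lam β γ).gibbsMeasure (N + 1) T)| ≤
        C * Real.exp (θ * (pinnedChain ω₂ lam β γ).hamiltonian (N + 1) z) * Real.exp (-c * t))
    (i : Fin (N + 1)) :
    (∫ t in Ioi (0 : ℝ), ((∫ z, (z.2 0) ^ 2 * (∫ y, (y.2 i) ^ 2
              ∂((pinnedChain ω₂ lam β γ).transitionKernel (N + 1) T T t.toNNReal z))
              ∂((pinnedChain ω₂ lam β γ).gibbsMeasure (N + 1) T)) -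
            (∫ z, (z.2 0) ^ 2 ∂((pinnedChain ω₂ lam β γ).gibbsMeasure (N + 1) T)) *
              (∫ z, (∫ y, (y.2 i) ^ 2
                ∂((pinnedChain ω₂ lam β γ).transitionKernel (N + 1) T T t.toNNReal z))
                ∂((pinnedChain ω₂ lam β γ).gibbsMeasure (N + 1) T)))) -
      ∫ t in Ioi (0 : ℝ), ((∫ z, (z.2 (Fin.last N)) ^ 2 * (∫ y, (y.2 i) ^ 2
              ∂((pinnedChain ω₂ lam β γ).transitionKernel (N + 1) T T t.toNNReal z))
              ∂((pinnedChain ω₂ lam β γ).gibbsMeasure (N + 1) T)) -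
            (∫ z, (z.2 (Fin.last N)) ^ 2 ∂((pinnedChain ω₂ lam β γ).gibbsMeasure (N + 1) T)) *
              (∫ z, (∫ y, (y.2 i) ^ 2
                ∂((pinnedChain ω₂ lam β γ).transitionKernel (N + 1) T T t.toNNReal z))
                ∂((pinnedChain ω₂ lam β γ).gibbsMeasure (N + 1) T))) =
    ∫ s in Ioi (0 : ℝ), ∫ z, ((z.2 0) ^ 2 - (z.2 (Fin.last N)) ^ 2) *
        (∫ y, (y.2 i) ^ 2 ∂((pinnedChain ω₂ lam β γ).transitionKernel (N + 1) T T s.toNNReal z))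
        ∂((pinnedChain ω₂ lam β γ).gibbsMeasure (N + 1) T) := by
  set P := pinnedChain ω₂ lam β γ with hPdef
  set μ₀ := P.gibbsMeasure (N + 1) T with hμ₀
  have hpT : ∀ j : Fin (N + 1), ∫ z, z.2 j ^ 2 ∂μ₀ = T := fun j => gibbs_sq_momentum hω hl hβ hT j
  obtain ⟨hY1, hYi⟩ := gibbs_cov_integrableOn_site hω hl hβ hγ hθ hc hH hT hθT rfl 0 i
  obtain ⟨hX1, hXi⟩ := gibbs_cov_integrableOn_site hω hl hβ hγ hθ hc hH hT hθT rfl (Fin.last N) i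
  rw [← integral_sub hYi hXi]
  refine integral_congr_ae (Eventually.of_forall fun t => ?_)
  beta_reduce
  rw [hpT, hpT]
  simp_rw [sub_mul]
  rw [integral_sub (hY1 t.toNNReal).1 (hX1 t.toNNReal).1]
  ring

/-! ### The stub -/

/-- **STUB `stub_profileLimitExchange` of line `Sketch` (crux `PuiseuxTransferLedger.TwoModeBulk`): the Gibbs TTCF
identity for `p_i²` → the linear response of the kinetic temperature AT EVERY SITE**
`(μ_{T+δ/2,T-δ/2}(p_i²) - T)/δ → (γ/2T²)(∫₀^∞ Y_i - ∫₀^∞ X_i)` (`δ → 0`, `δ ≠ 0`) along any steady family under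
weak-NESS uniqueness, `Y_i(t) = Cov_{μ₀}(p_0², K_t p_i²)`, `X_i(t) = Cov_{μ₀}(p_N², K_t p_i²)`.
The limit exists with value `(γ/2T²) Ψ_i(0)` by the landed `siteResponse_tendsto` (locally uniform Harris,
uniqueness, `S → ∞`, dominated convergence in `δ` with kernel continuity), fed with the TTCF hypothesis; the Harris
bound at `δ = 0` (`stub_uniformHarris_of_minorization`) has the Gibbs state as its limit (uniqueness,
`pinnedChain_isSteadyState_gibbsMeasure`), so `Ψ_i(0) = ∫ Y_i - ∫ X_i` (`integral_kubo_sub_auto_site`).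
Adapted from `BoundaryKubo.GibbsTtcf.stub_limitExchange`. [folklore] -/
theorem stub_profileLimitExchange :
    (∀ ω₂ lam β γ : ℝ, 0 < ω₂ → 0 < lam → 0 < β → 0 < γ → ∀ (N : ℕ) (T : ℝ), 0 < T →
      ∀ (i : Fin (N + 1)) (δ : ℝ), |δ| < 2 * T → ∀ S : ℝ, 0 ≤ S →
        (∫ z, (∫ y, (y.2 i) ^ 2
            ∂((Literature.MathematicalPhysics.KineticTheory.HeatConduction.pinnedChain ω₂ lam β γ).transitionKernel
              (N + 1) (T + δ / 2) (T - δ / 2) S.toNNReal z))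
            ∂((Literature.MathematicalPhysics.KineticTheory.HeatConduction.pinnedChain ω₂ lam β γ).gibbsMeasure
              (N + 1) T)) -
          (∫ z, (z.2 i) ^ 2
            ∂((Literature.MathematicalPhysics.KineticTheory.HeatConduction.pinnedChain ω₂ lam β γ).gibbsMeasure
              (N + 1) T)) =
        δ * (γ / (2 * T ^ 2)) *
          ∫ s in (0 : ℝ)..S, ∫ z, ((z.2 0) ^ 2 - (z.2 (Fin.last N)) ^ 2) *
            (∫ y, (y.2 i) ^ 2
              ∂((Literature.MathematicalPhysics.KineticTheory.HeatConduction.pinnedChain ω₂ lam β γ).transitionKernel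
                (N + 1) (T + δ / 2) (T - δ / 2) s.toNNReal z))
            ∂((Literature.MathematicalPhysics.KineticTheory.HeatConduction.pinnedChain ω₂ lam β γ).gibbsMeasure
              (N + 1) T)) →
    ∀ ω₂ lam β γ : ℝ, 0 < ω₂ → 0 < lam → 0 < β → 0 < γ →
      (∀ (N : ℕ) (T_L T_R : ℝ), 0 < T_L → 0 < T_R →
        ∀ μ ν : Measure (Literature.MathematicalPhysics.KineticTheory.HeatConduction.PhaseSpace N),
          (Literature.MathematicalPhysics.KineticTheory.HeatConduction.pinnedChain ω₂ lam β γ).IsSteadyState N T_L T_R μ →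
          (Literature.MathematicalPhysics.KineticTheory.HeatConduction.pinnedChain ω₂ lam β γ).IsSteadyState N T_L T_R ν →
          μ = ν) →
      ∀ μ : (N : ℕ) → ℝ → ℝ →
          Measure (Literature.MathematicalPhysics.KineticTheory.HeatConduction.PhaseSpace N),
        (∀ (N : ℕ) (T_L T_R : ℝ), 0 < T_L → 0 < T_R →
          (Literature.MathematicalPhysics.KineticTheory.HeatConduction.pinnedChain ω₂ lam β γ).IsSteadyState N T_L T_R
            (μ N T_L T_R)) →
        ∀ T : ℝ, 0 < T → ∀ (N : ℕ) (i : Fin (N + 1)),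
          Filter.Tendsto (fun δ : ℝ =>
              ((∫ z, (z.2 i) ^ 2 ∂(μ (N + 1) (T + δ / 2) (T - δ / 2))) - T) / δ)
            (nhdsWithin 0 {(0 : ℝ)}ᶜ)
            (nhds (γ / (2 * T ^ 2) *
              ((∫ t in Set.Ioi (0 : ℝ),
                ((∫ z, (z.2 0) ^ 2 * (∫ y, (y.2 i) ^ 2
                  ∂((Literature.MathematicalPhysics.KineticTheory.HeatConduction.pinnedChain ω₂ lam β γ).transitionKernel
                    (N + 1) T T t.toNNReal z))
                  ∂((Literature.MathematicalPhysics.KineticTheory.HeatConduction.pinnedChain ω₂ lam β γ).gibbsMeasure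
                    (N + 1) T)) -
                (∫ z, (z.2 0) ^ 2
                  ∂((Literature.MathematicalPhysics.KineticTheory.HeatConduction.pinnedChain ω₂ lam β γ).gibbsMeasure
                    (N + 1) T)) *
                  (∫ z, (∫ y, (y.2 i) ^ 2
                    ∂((Literature.MathematicalPhysics.KineticTheory.HeatConduction.pinnedChain ω₂ lam β γ).transitionKernel
                      (N + 1) T T t.toNNReal z))
                    ∂((Literature.MathematicalPhysics.KineticTheory.HeatConduction.pinnedChain ω₂ lam β γ).gibbsMeasure
                      (N + 1) T)))) -
              (∫ t in Set.Ioi (0 : ℝ),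
                ((∫ z, (z.2 (Fin.last N)) ^ 2 * (∫ y, (y.2 i) ^ 2
                  ∂((Literature.MathematicalPhysics.KineticTheory.HeatConduction.pinnedChain ω₂ lam β γ).transitionKernel
                    (N + 1) T T t.toNNReal z))
                  ∂((Literature.MathematicalPhysics.KineticTheory.HeatConduction.pinnedChain ω₂ lam β γ).gibbsMeasure
                    (N + 1) T)) -
                (∫ z, (z.2 (Fin.last N)) ^ 2
                  ∂((Literature.MathematicalPhysics.KineticTheory.HeatConduction.pinnedChain ω₂ lam β γ).gibbsMeasure
                    (N + 1) T)) *
                  (∫ z, (∫ y, (y.2 i) ^ 2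
                    ∂((Literature.MathematicalPhysics.KineticTheory.HeatConduction.pinnedChain ω₂ lam β γ).transitionKernel
                      (N + 1) T T t.toNNReal z))
                    ∂((Literature.MathematicalPhysics.KineticTheory.HeatConduction.pinnedChain ω₂ lam β γ).gibbsMeasure
                      (N + 1) T))))))) := by
  intro hH2 ω₂ lam β γ hω hl hβ hγ hU μ hμ T hT N i
  -- the limit exists, with value `(γ/2T²) Ψ_i(0)` (landed `siteResponse_tendsto`, fed with the TTCF hypothesis)
  have h := siteResponse_tendsto hω hl hβ hγ hU hμ hT N i
    (fun δ hδ S hS => hH2 ω₂ lam β γ hω hl hβ hγ N T hT i δ hδ S hS)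
  -- the Harris bound at `δ = 0`; its limit is the Gibbs state (uniqueness)
  have hH1 := stub_uniformHarris_of_minorization
    (stub_uniformMinorization_of stub_uniformLocalMinorization stub_uniformBallGeHalf stub_jointFeller)
  obtain ⟨δ₀, θ, C, c, hδ₀, -, hθ, hθT, -, hc, hfam⟩ := hH1 ω₂ lam β γ hω hl hβ hγ N T hT
  obtain ⟨ν, hst, -, hH⟩ := hfam 0 (by rw [abs_zero]; exact hδ₀.le)
  rw [zero_div, add_zero, sub_zero] at hst hH
  have hν : ν = (pinnedChain ω₂ lam β γ).gibbsMeasure (N + 1) T :=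
    hU (N + 1) T T hT hT _ _ hst (pinnedChain_isSteadyState_gibbsMeasure hω hl.le hβ.le γ (N + 1) hT)
  rw [hν] at hH
  -- the value `Ψ_i(0) = ∫ Y_i - ∫ X_i`
  rw [integral_kubo_sub_auto_site hω hl.le hβ.le hγ.le hT hθ hθT hc hH i]
  exact h

end Summit.AtomisticToContinuum.FouriersLaw.Theorems.TwoModeBulk.Sketch

end
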